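import Summits.MatrixMultiplication.MatrixMultiplication.Theorems.SoloBlindChainLemma

/-!
# Solo-blind seat (MatrixMultiplication), s71 — the anisotropy shield (paper/KraftK3.md §7.12, K3.12.18)

Why frames whose only value relation is `Q v_a + Q v_b = 0` (type (2,0)) survive: the cheapest network with that relation vector is the
REPEATED 3-CHAIN (directions `a, b, a`), support `{±v_a, −v_b, v_b ± v_a}`.  If these five points lie in one level set of `F = Q + ℓ`
then (`repeatedChain3_forces`) `Q v_a + Q v_b = 0` AND `polar Q v_a v_b = 0`, hence `Q (v_a + v_b) = 0` (`repeatedChain3_isotropic`):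
an isotropic vector.  So for ANISOTROPIC `Q` (only `0` has `Q = 0`) the repeated 3-chain is never realisable unless `v_a + v_b = 0`
(`repeatedChain3_not_realisable`) — anisotropy itself shields type-(2,0) frames from every defect-`≤ r` network, the mechanism behind
the 'if' half of Conjecture U (universal frames exist iff `n ≤ r + 1`).  Pure algebra over `ZMod 3`; no `ω` content.
-/

set_option linter.dupNamespace false
set_option autoImplicit false

namespace Summit.MatrixMultiplication.MatrixMultiplication.Theorems

variable {M N : Type*} [AddCommGroup M] [Module (ZMod 3) M] [AddCommGroup N] [Module (ZMod 3) N]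

/-- REPEATED 3-CHAIN forces the value relation and the vanishing of the polar: if `±a, -b, b + a, b - a` all lie in the level set
`{Q + ℓ = c}` then `Q a + Q b = 0` and `polar Q a b = 0`. -/
theorem repeatedChain3_forces (Q : QuadraticMap (ZMod 3) M N) (ℓ : M →ₗ[ZMod 3] N) (c : N) (a b : M)
    (h1 : Q a + ℓ a = c) (h2 : Q (-a) + ℓ (-a) = c) (h3 : Q (-b) + ℓ (-b) = c)
    (h4 : Q (b + a) + ℓ (b + a) = c) (h5 : Q (b - a) + ℓ (b - a) = c) :
    Q a + Q b = 0 ∧ QuadraticMap.polar Q a b = 0 := by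
  rw [QuadraticMap.map_neg, map_neg] at h2 h3
  rw [QuadraticMap.map_add Q b a, map_add, QuadraticMap.polar_comm] at h4
  rw [sub_eq_add_neg b a, QuadraticMap.map_add Q b (-a), QuadraticMap.map_neg, QuadraticMap.polar_neg_right, map_add, map_neg,
    QuadraticMap.polar_comm] at h5
  have ea := three_smul_eq_zero_zmod3 (Q a)
  have ep := three_smul_eq_zero_zmod3 (QuadraticMap.polar Q a b)
  constructor
  · linear_combination (norm := skip) h1 + h2 + (2 : ZMod 3) • h3 + h4 + h5 + ea
    match_scalars <;> decide
  · linear_combination (norm := skip) h1 + (2 : ZMod 3) • h2 + (2 : ZMod 3) • h4 + h5 + ep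
    match_scalars <;> decide

/-- … hence `a + b` is ISOTROPIC. -/
theorem repeatedChain3_isotropic (Q : QuadraticMap (ZMod 3) M N) (ℓ : M →ₗ[ZMod 3] N) (c : N) (a b : M)
    (h1 : Q a + ℓ a = c) (h2 : Q (-a) + ℓ (-a) = c) (h3 : Q (-b) + ℓ (-b) = c)
    (h4 : Q (b + a) + ℓ (b + a) = c) (h5 : Q (b - a) + ℓ (b - a) = c) :
    Q (a + b) = 0 := by
  obtain ⟨hq, hp⟩ := repeatedChain3_forces Q ℓ c a b h1 h2 h3 h4 h5
  rw [QuadraticMap.map_add Q a b, hp, add_zero, hq]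

/-- ANISOTROPY SHIELD: for an anisotropic `Q` (only `0` has `Q x = 0`) and `a + b ≠ 0`, the five points of the repeated 3-chain never lie
in one level set of `Q + ℓ`. -/
theorem repeatedChain3_not_realisable (Q : QuadraticMap (ZMod 3) M N) (hQ : ∀ x : M, Q x = 0 → x = 0)
    (ℓ : M →ₗ[ZMod 3] N) (c : N) (a b : M) (hab : a + b ≠ 0) :
    ¬ (Q a + ℓ a = c ∧ Q (-a) + ℓ (-a) = c ∧ Q (-b) + ℓ (-b) = c ∧ Q (b + a) + ℓ (b + a) = c ∧ Q (b - a) + ℓ (b - a) = c) := by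
  rintro ⟨h1, h2, h3, h4, h5⟩
  exact hab (hQ _ (repeatedChain3_isotropic Q ℓ c a b h1 h2 h3 h4 h5))

end Summit.MatrixMultiplication.MatrixMultiplication.Theorems
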